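import Summits.QuantumFields.BalabanUV.T4Continuum.Support.AveragingDeficitTransport

/-!
# T⁴ programme, node NE3, route P2 «ENERGY CONVEXITY» — leaf L3 at the competitor's end (the `res`-identification):
# the derivative of the Wilson action along a GENERAL differentiable path of perturbations `t ↦ W·exp Γ(t)` through the
# background (`Γ(t₀) = 0`) depends only on the velocity `Ψ = Γ′(t₀)` and equals the tree's first-variation sum
# `−Σ_p Re tr((d_W Ψ)(p)·W(∂p))`

Eleventh generation of the NE3 prover lineage P2 (unit `b2b-balaban-t4-ne3-p2`; ROUND-2 SKELETON-FIRST mandate), for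
the skeleton `HOME/t4/skeletons/NE3-t4-ne3-p2.md` (v1.5).  WHY.  In `Support/NE3EnergyAssembly.RouteLeaves` the field
`res : φ′(1) ≤ r·energyNorm W X` concerns the derivative AT THE COMPETITOR'S END of `φ(t) = A_{per}(W·exp Γ(t))` along the
admissible path `Γ` (B11's chart segment, `Γ(1) = 0`, field `endW`), while row Y9
(`Support/NE3EnergyResidual.abs_deriv_action_le_residualScale`) bounds the derivative at `0` of the STRAIGHT perturbation
`s ↦ A_{per}(W e^{sX})`.  This file bridges the two (all [folklore], kernel calculus): for ANY path `Γ` of direction fields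
with `Γ(t₀) = 0` bondwise and bondwise derivative `Ψ` at `t₀`,
  `d/dt|_{t₀} Σ_{p∈Wn}(1 − Re tr (W·exp Γ(t))(∂p)) = −Σ_{p∈Wn} Re tr((d_W Ψ)(p)·W(∂p))`
(**`hasDerivAt_fineAction_path`**, §3) — the SAME value as the tree's `hasDerivAt_fineAction_vary W Ψ` at `s = 0`; hence
(`deriv_fineAction_path_eq`) `φ′(t₀) = D` for every `D` with `HasDerivAt (s ↦ fineAction (vary W Ψ s) Wn) D 0`, and the
bound of row Y9 applies verbatim with `X := Ψ` (for the chart segment `Ψ = Γ′(1) = −X₀`, B11 (55): `D′(0) = 0`).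
§1 one letter (`hasDerivAt_val_stepHol_path`: Mathlib `hasFDerivAt_exp_zero` composed with the bondwise curve), §2 a word
(`hasDerivAt_val_hol_path`: induction as in the tree's `hasDerivAt_val_hol_vary_word`, same left-trivialised derivative
`dhol W Ψ x w · W(w)`), §3 the action.

HONEST FRAMING.  Finite-T⁴ bookkeeping (rung (B)+1); elementary calculus; NOTHING about Bałaban's minimisers is asserted;
no conditional of the cell is used or hidden; NOT infinite volume ∕ mass gap ∕ Clay ∕ summit progress; NE3 NOT proved.
ABSOLUTE RULE kept: no printed sentence is a hypothesis (context: [Balaban1985Variational] (47), (55) pp. 285–287, (81)–(84)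
p. 290; [Balaban1985Averaging] (9) p. 18).  PLACEMENT: `Summits/QuantumFields/BalabanUV/`; imports the accepted
`Support.AveragingDeficitTransport` only; moves nothing.
-/

set_option autoImplicit false

open scoped BigOperators Matrix Matrix.Norms.L2Operator
open NormedSpace Finset

namespace Summit.QuantumFields.BalabanUV.T4Continuum.NE3EnergyPathEnd

open Literature.MathematicalPhysics.QuantumFieldTheory.Balaban1983to89
open B7Prop1Explicit B7Prop2Explicit MatrixLog UnitaryModel
open T4AveragingDeficitWall hiding Site Plane Plaq Bond
open AveragingDeficitTransport (dstep dhol dhol_nil dhol_cons dhol_plaqWord Ad_mul_val)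

noncomputable section

variable {d : ℕ} {n : Type*} [Fintype n] [DecidableEq n]

/-! ## §1 One letter along a general path -/

/-- `d/dt|_{t₀} exp(γ(t)) = γ′(t₀)` for a matrix-valued curve with `γ(t₀) = 0` (Mathlib `hasFDerivAt_exp_zero`: the
Fréchet derivative of `exp` at `0` is the identity). [folklore] -/
theorem hasDerivAt_exp_path {γ : ℝ → Matrix n n ℂ} {Y : Matrix n n ℂ} {t₀ : ℝ} (h0 : γ t₀ = 0)
    (hγ : HasDerivAt γ Y t₀) : HasDerivAt (fun t => exp (γ t)) Y t₀ := by
  have he : HasFDerivAt (exp : Matrix n n ℂ → Matrix n n ℂ) ((1 : Matrix n n ℂ →L[ℂ] Matrix n n ℂ).restrictScalars ℝ)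
      (γ t₀) := by
    rw [h0]
    exact (hasFDerivAt_exp_zero (𝕂 := ℂ)).restrictScalars ℝ
  have h := he.comp_hasDerivAt t₀ hγ
  exact h

/-- `d/dt|_{t₀} exp(−γ(t)) = −γ′(t₀)` under `γ(t₀) = 0`. [folklore] -/
theorem hasDerivAt_exp_neg_path {γ : ℝ → Matrix n n ℂ} {Y : Matrix n n ℂ} {t₀ : ℝ} (h0 : γ t₀ = 0)
    (hγ : HasDerivAt γ Y t₀) : HasDerivAt (fun t => exp (-γ t)) (-Y) t₀ :=
  hasDerivAt_exp_path (γ := fun t => -γ t) (by simp [h0]) hγ.neg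

/-- **ONE LETTER**: along `t ↦ W·exp Γ(t)` (tree `vary W (Γ t) 1`) with `Γ(t₀) = 0` and bondwise velocity `Ψ` at `t₀`,
the transport across one letter differentiates to `dstep W Ψ · stepHol W` — the same as for the straight perturbation
`W e^{sΨ}` at `s = 0` (tree `hasDerivAt_val_stepHol_vary`). [folklore] -/
theorem hasDerivAt_val_stepHol_path (W : B7Prop1Explicit.Site d → Fin d → (Matrix n n ℂ)ˣ)
    {Γ : ℝ → B7Prop1Explicit.Site d → Fin d → Matrix n n ℂ} {Ψ : B7Prop1Explicit.Site d → Fin d → Matrix n n ℂ} {t₀ : ℝ}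
    (h0 : ∀ y κ, Γ t₀ y κ = 0) (hΓ : ∀ y κ, HasDerivAt (fun t => Γ t y κ) (Ψ y κ) t₀)
    (x : B7Prop1Explicit.Site d) (l : Letter d) :
    HasDerivAt (fun t : ℝ => ((stepHol (vary W (Γ t) 1) x l : (Matrix n n ℂ)ˣ) : Matrix n n ℂ))
      (dstep W Ψ x l * ((stepHol W x l : (Matrix n n ℂ)ˣ) : Matrix n n ℂ)) t₀ := by
  obtain ⟨μ, b⟩ := l
  cases b
  · -- backward letter: `exp(−Γ t b) · W(b)⁻¹`
    have hb := hasDerivAt_exp_neg_path (h0 (x + Letter.vec (μ, false)) μ) (hΓ (x + Letter.vec (μ, false)) μ)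
    have h := hb.mul_const ((((W (x + Letter.vec (μ, false)) μ)⁻¹ : (Matrix n n ℂ)ˣ) : Matrix n n ℂ))
    have e1 : (fun t : ℝ => ((stepHol (vary W (Γ t) 1) x (μ, false) : (Matrix n n ℂ)ˣ) : Matrix n n ℂ))
        = fun t : ℝ => exp (-Γ t (x + Letter.vec (μ, false)) μ)
            * (((W (x + Letter.vec (μ, false)) μ)⁻¹ : (Matrix n n ℂ)ˣ) : Matrix n n ℂ) := by
      funext t
      simp only [stepHol, Bool.false_eq_true, ↓reduceIte, vary, mul_inv_rev, Units.val_mul, val_inv_expUnit,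
        val_expUnit, Complex.ofReal_one, one_smul]
    rw [e1]
    refine h.congr_deriv ?_
    simp only [dstep, Bool.false_eq_true, ↓reduceIte, stepHol, neg_mul]
  · -- forward letter: `W(b) · exp(Γ t b)`
    have hb := hasDerivAt_exp_path (h0 x μ) (hΓ x μ)
    have h := hb.const_mul ((W x μ : (Matrix n n ℂ)ˣ) : Matrix n n ℂ)
    have e1 : (fun t : ℝ => ((stepHol (vary W (Γ t) 1) x (μ, true) : (Matrix n n ℂ)ˣ) : Matrix n n ℂ))
        = fun t : ℝ => ((W x μ : (Matrix n n ℂ)ˣ) : Matrix n n ℂ) * exp (Γ t x μ) := by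
      funext t
      simp only [stepHol, ↓reduceIte, vary, Units.val_mul, val_expUnit, Complex.ofReal_one, one_smul]
    rw [e1]
    refine h.congr_deriv ?_
    simp only [dstep, ↓reduceIte, stepHol]
    rw [Ad_mul_val]

/-! ## §2 A word along a general path -/

/-- The configuration at the base time is the background: `W·exp Γ(t₀) = W`. [folklore] -/
theorem vary_path_base (W : B7Prop1Explicit.Site d → Fin d → (Matrix n n ℂ)ˣ)
    {Γ : ℝ → B7Prop1Explicit.Site d → Fin d → Matrix n n ℂ} {t₀ : ℝ} (h0 : ∀ y κ, Γ t₀ y κ = 0) :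
    vary W (Γ t₀) 1 = W := by
  have : Γ t₀ = fun _ _ => 0 := by funext y κ; exact h0 y κ
  rw [this]; exact vary_zero_dir W 1

/-- **A WORD**: `d/dt|_{t₀} (W·exp Γ(t))(Γ_w) = (δ_Ψ W)(Γ_w) · W(Γ_w)` — induction on the word exactly as the tree's
`hasDerivAt_val_hol_vary_word`, with §1 for the letters. [folklore] -/
theorem hasDerivAt_val_hol_path (W : B7Prop1Explicit.Site d → Fin d → (Matrix n n ℂ)ˣ)
    {Γ : ℝ → B7Prop1Explicit.Site d → Fin d → Matrix n n ℂ} {Ψ : B7Prop1Explicit.Site d → Fin d → Matrix n n ℂ} {t₀ : ℝ}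
    (h0 : ∀ y κ, Γ t₀ y κ = 0) (hΓ : ∀ y κ, HasDerivAt (fun t => Γ t y κ) (Ψ y κ) t₀) :
    ∀ (w : List (Letter d)) (x : B7Prop1Explicit.Site d),
      HasDerivAt (fun t : ℝ => ((hol (vary W (Γ t) 1) x w : (Matrix n n ℂ)ˣ) : Matrix n n ℂ))
        (dhol W Ψ x w * ((hol W x w : (Matrix n n ℂ)ˣ) : Matrix n n ℂ)) t₀
  | [], x => by
      simp only [hol_nil, Units.val_one, dhol_nil, zero_mul]
      exact hasDerivAt_const _ _
  | l :: w, x => by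
      have h := (hasDerivAt_val_stepHol_path W h0 hΓ x l).mul (hasDerivAt_val_hol_path W h0 hΓ w (x + l.vec))
      have e1 : (fun t : ℝ => ((hol (vary W (Γ t) 1) x (l :: w) : (Matrix n n ℂ)ˣ) : Matrix n n ℂ))
          = fun t : ℝ => ((stepHol (vary W (Γ t) 1) x l : (Matrix n n ℂ)ˣ) : Matrix n n ℂ)
              * ((hol (vary W (Γ t) 1) (x + l.vec) w : (Matrix n n ℂ)ˣ) : Matrix n n ℂ) := by
        funext t
        rw [hol_cons, Units.val_mul]
      rw [e1]
      refine h.congr_deriv ?_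
      simp only [vary_path_base W h0, dhol_cons, hol_cons, Units.val_mul]
      unfold Ad
      simp only [add_mul, mul_assoc, Units.inv_mul_cancel_left]

/-! ## §3 The Wilson action along a general path -/

/-- One Wilson weight along the path: `d/dt|_{t₀} (1 − Re tr (W·exp Γ(t))(∂p)) = −Re tr((d_W Ψ)(p)·W(∂p))`.
[folklore] -/
theorem hasDerivAt_wt_fhol_path (W : B7Prop1Explicit.Site d → Fin d → (Matrix n n ℂ)ˣ)
    {Γ : ℝ → B7Prop1Explicit.Site d → Fin d → Matrix n n ℂ} {Ψ : B7Prop1Explicit.Site d → Fin d → Matrix n n ℂ} {t₀ : ℝ}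
    (h0 : ∀ y κ, Γ t₀ y κ = 0) (hΓ : ∀ y κ, HasDerivAt (fun t => Γ t y κ) (Ψ y κ) t₀)
    (p : T4AveragingDeficitWall.Plaq d) :
    HasDerivAt (fun t : ℝ => wt (fhol (vary W (Γ t) 1) p))
      (-nReTr (curl W Ψ p * ((fhol W p : (Matrix n n ℂ)ˣ) : Matrix n n ℂ))) t₀ := by
  have hh := hasDerivAt_val_hol_path W h0 hΓ (plaqWord p.2.1.1 p.2.1.2) p.1
  rw [dhol_plaqWord] at hh
  have h := ((nReTrL (n := n)).hasFDerivAt.comp_hasDerivAt t₀ hh).const_sub 1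
  simpa [wt, fhol, curl, Function.comp_def] using h

/-- **THE WILSON ACTION ALONG A GENERAL PATH THROUGH THE BACKGROUND**: for every finite window `Wn`,
`d/dt|_{t₀} A_{Wn}(W·exp Γ(t)) = −Σ_{p∈Wn} Re tr((d_W Ψ)(p)·W(∂p))`, `Ψ` the bondwise velocity of `Γ` at `t₀` where
`Γ(t₀) = 0`.  The right side is LITERALLY the derivative of the tree's `hasDerivAt_fineAction_vary W Ψ Wn`. [folklore] -/
theorem hasDerivAt_fineAction_path (W : B7Prop1Explicit.Site d → Fin d → (Matrix n n ℂ)ˣ)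
    {Γ : ℝ → B7Prop1Explicit.Site d → Fin d → Matrix n n ℂ} {Ψ : B7Prop1Explicit.Site d → Fin d → Matrix n n ℂ} {t₀ : ℝ}
    (h0 : ∀ y κ, Γ t₀ y κ = 0) (hΓ : ∀ y κ, HasDerivAt (fun t => Γ t y κ) (Ψ y κ) t₀)
    (Wn : Finset (T4AveragingDeficitWall.Plaq d)) :
    HasDerivAt (fun t : ℝ => fineAction (vary W (Γ t) 1) Wn)
      (-∑ p ∈ Wn, nReTr (curl W Ψ p * ((fhol W p : (Matrix n n ℂ)ˣ) : Matrix n n ℂ))) t₀ := by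
  have h := HasDerivAt.sum (u := Wn) (x := t₀) (A := fun p t => wt (fhol (vary W (Γ t) 1) p))
    (A' := fun p => -nReTr (curl W Ψ p * ((fhol W p : (Matrix n n ℂ)ˣ) : Matrix n n ℂ)))
    fun p _ => hasDerivAt_wt_fhol_path W h0 hΓ p
  simpa [fineAction, Finset.sum_fn] using h

/-- **THE `res`-IDENTIFICATION**: the derivative of the action along the path at `t₀` EQUALS every derivative `D` of
the straight perturbation `s ↦ A_{Wn}(W e^{sΨ})` at `0` (uniqueness of derivatives) — so row Y9's bound on `|D|`
(`NE3EnergyResidual.abs_deriv_action_le_residualScale`, with `X := Ψ`) IS the bound on `φ′(t₀)` that the field `res` of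
`NE3EnergyAssembly.RouteLeaves` asks for (there `t₀ = 1`, `Ψ = Γ′(1) = −X₀` for B11's chart segment). [folklore] -/
theorem deriv_fineAction_path_eq (W : B7Prop1Explicit.Site d → Fin d → (Matrix n n ℂ)ˣ)
    {Γ : ℝ → B7Prop1Explicit.Site d → Fin d → Matrix n n ℂ} {Ψ : B7Prop1Explicit.Site d → Fin d → Matrix n n ℂ} {t₀ : ℝ}
    (h0 : ∀ y κ, Γ t₀ y κ = 0) (hΓ : ∀ y κ, HasDerivAt (fun t => Γ t y κ) (Ψ y κ) t₀)
    (Wn : Finset (T4AveragingDeficitWall.Plaq d)) {φ' D : ℝ}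
    (hφ : HasDerivAt (fun t : ℝ => fineAction (vary W (Γ t) 1) Wn) φ' t₀)
    (hD : HasDerivAt (fun s : ℝ => fineAction (vary W Ψ s) Wn) D 0) : φ' = D := by
  rw [hφ.unique (hasDerivAt_fineAction_path W h0 hΓ Wn), hD.unique (hasDerivAt_fineAction_vary W Ψ Wn)]

end

end Summit.QuantumFields.BalabanUV.T4Continuum.NE3EnergyPathEnd
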